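import Summits.BirchSwinnertonDyer.Rank1Residual.F1Sign2.WildPacketAtTwo
import Literature.NumberTheory.EllipticCurves.PAdicHeights
import Literature.NumberTheory.QuadraticForms.HilbertSymbol
import HarnessLib

/-!
# Cell `bsd-f1-sign2`, AN-32⁺: THE WILD PACKET READS THE POSITION of `loc₂ κ(R)` (a ≥ 1 rows: `E(ℚ₂)[2] ≠ 0`) (-an g15, MEMO-an v1.26 §2; Sketch_v23.lean §5)

TYPER FILING (cell `bsd-f1-sign2`, seat `-ty` g10; CANDIDATES.md rows AN-32⁺m0/m1/s/o/f + AN-32K′/AN-32↑′ (`Addv` forms); sibling of `F1Sign2/WildPacketAtTwo.lean`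
p638887, which holds §0–§4 = the REF1 §111-audited block; gate D-ty-ref1-27 CLEARED by REF1 §114: draft 67ae1fc59297831d = sketch a407582d §5, cmpdecls 12/12): the §5 block of the `ANg15.WildPacket` namespace of `HOME/MEMO-an-data/g15/Sketch_v23.lean` a407582d2f0b2171
(-an: farm rc 0, 0 sorry; BC7 15/15 CLEAN `g15/bc/Probe_v23c.lean`) VERBATIM under the cell namespace `…Rank1Residual.F1Sign2.WildPacket`
(statement-only: `def … : Prop` + the kernel glue `splitWildTrit_of_lines`; axioms standard), followed by the `Addv`-restricted AN-32K′
`AdditiveTwinUnitValueKillsSelmerTwoAtTwo` (`@[conjecture]`) / AN-32↑′ `UBottomOnPrimitiveLocusAddvAtTwo` (sketch l.209–234 verbatim under NEW names, REF1 §114 r6;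
-an adopted REF1 §111 r1 after p638887 was in the gate; append-only) with glue `uBottomOnPrimitiveLocusAddv_of` and the restrictions from the landed
¬good forms `additiveTwinUnitValueKillsSelmerTwoAtTwo_of` / `uBottomOnPrimitiveLocusAddvAtTwo_of` (PROVED).  Carriers `WildPacketDelta`, `ArchSilentAtTwo`,
`discHilbertAtTwo` (tree `Literature.NumberTheory.QuadraticForms.hilbertSymbol` over `ℚ_[2]`), `TwoTorsionLineAtTwo`, `SliceRowAtTwo`,
`MultiplicativePartialAtTwo`; rows AN-32⁺m0 `MultiplicativeSilentTwinAtTwo`, AN-32⁺m1 `MultiplicativeWildLinesDistinctAtTwo`, AN-32⁺s `SplitWildTritAtTwo`,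
AN-32⁺o `OrdinaryWildPairAtTwo`, AN-32⁺f `OrdinaryFullTwinAtTwo` (THEOREM-CANDIDATES: Kramer 1981 Props. 1, 2(b), 5, 6, 7 exact local norm indices +
the Poitou–Tate three-Lagrangian count).  Typer edits = this header, the imports (route-file import dropped; `F1Sign2.WildPacketAtTwo` +
`QuadraticForms.HilbertSymbol` + `EllipticCurves.PAdicHeights`) and the REF1/REF2 sentences.  Nothing is asserted.
Census = BC5 WITNESS: ENGINE W kit j309252 (tag `bsd-frontier-data`) a ≥ 1 rows (283 ordinary + 284 split + 259 non-split (+ 212 additive, parity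
only)), `HOME/MEMO-an-data/g15/jobW2/ANALYSIS-Wplus.txt` (`analyseW_plus.py`): shape 2 478/2 478, Kramer index ≡ Kramer–Tunnell parity 2 478/2 478,
parity incl. additive 3 114/3 114; exact predictions: silent 806/806, ordinary full `t = 2` twins 178/178, `β = 0` partial 80/80; POSITION: split three
partial twins (Δ < 0) r-vector has EXACTLY ONE ZERO 45/45; multiplicative pairs never `(0,0)` 233/233; ordinary pairs `(0,0)` 16, `(1,1)` 136, mixed 0/152.
REF1-AUDIT §114 (= §111 amendment; refuter-bsd-f1-sign2-ref1 g10, 2026-08-28T14:28:31Z; evidence `HOME/REF1-data/b114/`, `b115/`): «AN-32⁺ rows of Sketch_v23 a407582d §5 (= draft 67ae1fc59297831d, cmpdecls 12/12) — `MultiplicativeSilentTwinAtTwo`, `MultiplicativeWildLinesDistinctAtTwo`, `SplitWildTritAtTwo`, `OrdinaryWildPairAtTwo`, `OrdinaryFullTwinAtTwo` ALL SURVIVE, theorem-grade in substance (Kramer 1981 Props 1, 2(b), 5, 6 + Poitou–Tate); carriers correct (`discHilbertAtTwo` = (Δ,δ)₂ via tree `hilbertSymbol ℚ_[2]`, 2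 478/2 478 vs engine); glue `splitWildTrit_of_lines` trio; KILLED none; rc 0; literal recount on ENGINE W j309252: m0 600/600 + 218/218, m1 466/466 + 466/466, s 45/45, o 668/668 + 304/304, f 178/178, 0 violations; mutation: β = 1 and a = 1 load-bearing; D-an-69: norm lines identified explicitly (split: N_{−1} = U₂-line, N_2 = torsion line, N_{−2} = third — proved; non-split: N_{−1} = U₂-line, N_{−2} = torsion, N_2 = third — 238/238; ordinary (Δ,δ)₂ = −1: N = formal-group line (E₁+2E)/2E — proved; 756/756 readings); AN-32K/↑ Addv restriction = §111 r1, verdicts of §111 stand.» Riders (docstring-only): r1 `TwoTorsionLineAtTwo` in m1/s is implied by the slice for multiplicative `W` (kept, harmless); r2 (m1) the norm lines are EXPLICIT — split (v₂q odd): N_{−1} = ⟨5⟩ = the U₂-line (c₂R ∈ E₂(ℚ₂)), N_2 = ⟨−1⟩ = ⟨T⟩, N_{−2} = ⟨−5⟩ (readings 84/84 · 143/143 · 79/79); non-split: N_{−1} = U₂-line, N_{−2} = ⟨T⟩, N_2 = third (2 ↔ −2 swap; 67/67 · 71/71 · 100/100); r3 (o) «their norm lines coincide» = both equal the formal-group line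 (E₁(ℚ₂)+2E(ℚ₂))/2E(ℚ₂): norms from a ramified quadratic extension reduce into 2Ẽ(𝔽₂), index 2 = Kramer Prop 5 (reading (4,4) ⟺ R̃ ∈ 2Ẽ(𝔽₂), 212/212; the torsion line ⟨T⟩ only when E(ℚ₂)[4] = E(ℚ₂)[2]); r4 `splitWildTrit_of_lines`'s `h3` = «three distinct lines exhaust 𝔽₂²», dischargeable once m1 is phrased on lines; r5 (-an, -data) reconcile β on 10451a1 (engine B = REF1 = 0, engine S = 1); suggested closed-form trit/pair rows (§114) are -an's to type. §115: p638887/p639275/p639636 CERTIFIED (statements = audited sketch 21/21; `twistSelmerModelInvarianceAtTwo_holds` has literally the audited row as type).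
REF2-PLACEMENT (refuter-bsd-f1-sign2-ref2 g31, via REF1 §114 cc, 2026-08-28T14:28:31Z): «the line identifications are elementary — Kramer 1981 Props 1/2/5 + unit Hilbert symbols; nothing new to place»; the §0–§4 packet's placement is REF2 v30 §1 (sibling file's docstring): formula VARIANT, reading NEW-COMBINATION cell-internal; AN-32K′ OPEN conjecture-grade (Kato 14.5(3) p ≠ 2 ∧ pot. good); beyond-print theorem: no. [cite: Kramer1981, Prop. 1, Prop. 2, Prop. 5, Prop. 6, Prop. 7] [cite: MazurRubin2010, Lemma 3.1, Lemma 3.2, Prop. 3.3] [cite: Kato2004Asterisque, Thm. 14.5]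
PARTITION: none moved (frontier tier; the a ≥ 1 rows of the wild-packet reading, companion of crux idea `wild-twin-bottom-bit` on stmt-23715);
beyond-print theorem: no.  BSD is not proved by any of this.
bears_on: crux stmt-BirchSwinnertonDyer-23715; evidence ×3 (-an g15 v1.26).
-/

set_option autoImplicit false

noncomputable section

open scoped Classical

namespace Summit.BirchSwinnertonDyer.Rank1Residual.F1Sign2.WildPacket

open Literature.NumberTheory.EllipticCurves Literature.NumberTheory.EllipticCurves.Rank1Residual

/-! ### §5 AN-32⁺ (a ≥ 1 rows: E(ℚ₂)[2] ≠ 0) — THE WILD PACKET READS THE POSITION of `loc₂ κ(R)` in the plane `E(ℚ₂)/2E(ℚ₂) ≅ (ℤ/2)²`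

On the ordinary / multiplicative part of the rank-one slice Kramer 1981 gives the EXACT local norm index `i₂(δ)` of the ramified twist `ℚ₂(√δ)`,
`δ ∈ {−1, 2, −2}`, from the Hilbert symbol `(Δ_E, δ)₂` (Prop. 1 split: `i₂ = [(Δ,δ)₂ = +1]`; Prop. 2(b) non-split: `1` if `(Δ,δ)₂ = −1`, else `0`/`2` as
`v₂(Δ)` is odd/even; Prop. 5 ordinary: `2` if `(Δ,δ)₂ = +1`, `1` if `−1`; Prop. 6: `i_∞ = [δ < 0 ∧ Δ > 0]`), and the Poitou–Tate three-Lagrangian count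
(image of the relaxed Selmer group, `W_E = ⊕ H_v/(H_v ∩ H_v^δ)`, `W_δ`) gives `dim Sel₂(E^{(δ)}) = 1 − r + b`, `0 ≤ b ≤ t − r`, `b ≡ t − r (2)`,
`t = i₂ + i_∞`, `r = [loc_T κ(R) ∉ ⊕_v (H_v ∩ H_v^δ)]`.  SILENT twins (`i₂ = 0`) and `t = 1` twins are predicted EXACTLY; on `t = 1` ("partial")
twins with `β = 1` the bit `r₂(δ) = [loc₂ κ(R) ∉ N_δ]` (`N_δ` = the norm LINE of `E(ℚ₂(√δ))`) is READ OFF as `(2 − dim)/2`.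
Census ENGINE W rows (kit j309252, a ≥ 1: 283 ordinary + 284 split + 259 non-split (+ 212 additive, parity only)), `jobW2/ANALYSIS-Wplus.txt`:
shape 2 478/2 478, Kramer index ≡ Kramer–Tunnell parity 2 478/2 478, parity incl. additive 3 114/3 114; exact predictions: silent 806/806,
ordinary full `t = 2` twins 178/178 (`dim = 1` exactly), `β = 0` partial 80/80; POSITION: split, three partial twins (Δ < 0): r-vector has EXACTLY ONE
ZERO 45/45 (the three norm lines `N_{−1}, N_2, N_{−2}` are the three distinct lines of the plane — the packet reads the TRIT); multiplicative pairs never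
`(0,0)` 233/233; ORDINARY pairs of partial twins: `(0,0)` 16, `(1,1)` 136, mixed 0/152 (the two `(Δ,δ)₂ = −1` twins have the SAME norm line). -/

/-- the wild packet. -/
def WildPacketDelta (δ : ℤ) : Prop := δ = -1 ∨ δ = 2 ∨ δ = -2

/-- `i_∞(δ) = 0`: the twist does not move the local condition at `∞` (Kramer Prop. 6). -/
def ArchSilentAtTwo (W : WeierstrassCurve ℚ) (δ : ℤ) : Prop := W.Δ < 0 ∨ 0 < δ

/-- `(Δ_E, δ)₂`, the `2`-adic Hilbert symbol (tree `Literature.NumberTheory.QuadraticForms.hilbertSymbol` over `ℚ_[2]`). -/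
def discHilbertAtTwo (W : WeierstrassCurve ℚ) (δ : ℤ) : ℤ :=
  Literature.NumberTheory.QuadraticForms.hilbertSymbol ℚ_[2] ((W.Δ : ℚ) : ℚ_[2]) ((δ : ℚ) : ℚ_[2])

/-- `E(ℚ₂)[2] ≅ ℤ/2` exactly (for ordinary or multiplicative reduction at `2`: `E(ℚ₂)[2] ≠ 0` always, and `= (ℤ/2)²` iff `Δ_E ∈ ℚ₂^{×2}`). -/
def TwoTorsionLineAtTwo (W : WeierstrassCurve ℚ) : Prop := ¬ IsSquare ((W.Δ : ℚ) : ℚ_[2])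

/-- the common hypotheses of the a ≥ 1 slice rows: odd torsion, odd Tamagawa product (⟹ `i_ℓ = 0` at every odd bad prime), rank one, `#Sel₂(E) = 2`. -/
def SliceRowAtTwo (W : WeierstrassCurve ℚ) [W.IsGloballyMinimal] : Prop :=
  Odd W.torsionOrder ∧ Odd W.tamagawaProduct ∧ W.mordellWeilRank = 1 ∧ selmerTwoCard W = 2

/-- **AN-32⁺m0 `MultiplicativeSilentTwinAtTwo` (THEOREM-CANDIDATE; 806/806).** Multiplicative at `2`, silent twin (`i₂(δ) = 0`: split with
`(Δ,δ)₂ = −1`, or non-split with `(Δ,δ)₂ = +1` — `v₂(Δ)` is odd since `c₂` is odd): `#Sel₂(E^{(δ)}) = 2` if `i_∞ = 0`; at `Δ > 0`, `δ < 0` the egg bit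
decides: `#Sel₂(E^{(δ)}) = 1` on egg-meeting curves, `4` otherwise. [cite: Kramer1981, Props. 1, 2(b), 6] [cite: MazurRubin2010, proof of Prop. 3.3] -/
def MultiplicativeSilentTwinAtTwo : Prop :=
  ∀ (W : WeierstrassCurve ℚ) [W.IsElliptic] [W.IsGloballyMinimal], W.HasMultiplicativeReductionAtPrime 2 → SliceRowAtTwo W →
    ∀ δ : ℤ, WildPacketDelta δ →
      ((W.HasSplitMultiplicativeReductionAtPrime 2 ∧ discHilbertAtTwo W δ = -1) ∨
        (¬ W.HasSplitMultiplicativeReductionAtPrime 2 ∧ discHilbertAtTwo W δ = 1)) →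
      (ArchSilentAtTwo W δ → twistSelmerTwoCard W δ = 2) ∧
      (0 < W.Δ → δ < 0 → (MeetsEgg W → twistSelmerTwoCard W δ = 1) ∧ (¬ MeetsEgg W → twistSelmerTwoCard W δ = 4))

/-- "partial" twin at a multiplicative `2` (`i₂(δ) = 1 < 2 = dim E(ℚ₂)/2E(ℚ₂)`): split with `(Δ,δ)₂ = +1`, or non-split with `(Δ,δ)₂ = −1`. -/
def MultiplicativePartialAtTwo (W : WeierstrassCurve ℚ) (δ : ℤ) : Prop :=
  (W.HasSplitMultiplicativeReductionAtPrime 2 ∧ discHilbertAtTwo W δ = 1) ∨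
    (¬ W.HasSplitMultiplicativeReductionAtPrime 2 ∧ discHilbertAtTwo W δ = -1)

/-- **AN-32⁺m1 `MultiplicativeWildLinesDistinctAtTwo` (THEOREM-CANDIDATE; 233/233 pairs, 45/45 split triples with exactly one zero).** Multiplicative at
`2`, `E(ℚ₂)[2] ≅ ℤ/2`, `β = 1`: two distinct partial twins of the packet, both silent at `∞`, are never BOTH of Selmer rank `2` — the norm lines
`N_{δ₁} ≠ N_{δ₂}` in `E(ℚ₂)/2E(ℚ₂)` (Tate parametrisation: `N_δ = {u : (u,δ)₂ = 1}/⟨q⟩`), so `loc₂ κ(R) ≠ 0` lies on at most one of them; each partial twin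
has `#Sel₂ ∈ {1, 4}` (`= 4` iff `loc₂ κ(R) ∈ N_δ`).  REF1 §114: SURVIVES, theorem-grade in substance; r2 (D-an-69) the lines are EXPLICIT — split
(`v₂ q` odd): `N_{−1} = ⟨5⟩` = the `U₂`-line (`c₂R ∈ E₂(ℚ₂)`), `N_2 = ⟨−1⟩ = ⟨T⟩`, `N_{−2} = ⟨−5⟩` (84/84 · 143/143 · 79/79); non-split: `N_{−1}` = `U₂`-line,
`N_{−2} = ⟨T⟩`, `N_2` = third (`2 ↔ −2` swap; 67/67 · 71/71 · 100/100); r1 `TwoTorsionLineAtTwo` is implied by the slice here (kept).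
[cite: Kramer1981, Props. 1, 2(b), 7] [cite: MazurRubin2010, Lemma 3.2, proof of Prop. 3.3] -/
def MultiplicativeWildLinesDistinctAtTwo : Prop :=
  ∀ (W : WeierstrassCurve ℚ) [W.IsElliptic] [W.IsGloballyMinimal], W.HasMultiplicativeReductionAtPrime 2 → TwoTorsionLineAtTwo W → SliceRowAtTwo W →
    LocallyPrimitiveAtTwo W → ∀ δ₁ δ₂ : ℤ, WildPacketDelta δ₁ → WildPacketDelta δ₂ → δ₁ ≠ δ₂ →
      MultiplicativePartialAtTwo W δ₁ → MultiplicativePartialAtTwo W δ₂ → ArchSilentAtTwo W δ₁ → ArchSilentAtTwo W δ₂ →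
      (twistSelmerTwoCard W δ₁ = 1 ∨ twistSelmerTwoCard W δ₁ = 4) ∧ ¬ (twistSelmerTwoCard W δ₁ = 4 ∧ twistSelmerTwoCard W δ₂ = 4)

/-- **AN-32⁺s `SplitWildTritAtTwo` (THEOREM-CANDIDATE; 45/45).** Split multiplicative at `2`, `Δ < 0`, `E(ℚ₂)[2] ≅ ℤ/2`, `β = 1`, all three symbols
`(Δ,δ)₂ = +1`: EXACTLY ONE twin of the packet has `#Sel₂ = 4` and the other two have `#Sel₂ = 1` — the packet reads WHICH of the three lines of
`E(ℚ₂)/2E(ℚ₂)` the class `loc₂ κ(R)` spans. -/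
def SplitWildTritAtTwo : Prop :=
  ∀ (W : WeierstrassCurve ℚ) [W.IsElliptic] [W.IsGloballyMinimal], W.HasSplitMultiplicativeReductionAtPrime 2 → TwoTorsionLineAtTwo W → SliceRowAtTwo W →
    LocallyPrimitiveAtTwo W → W.Δ < 0 → discHilbertAtTwo W (-1) = 1 → discHilbertAtTwo W 2 = 1 → discHilbertAtTwo W (-2) = 1 →
      (twistSelmerTwoCard W (-1) = 4 ∧ twistSelmerTwoCard W 2 = 1 ∧ twistSelmerTwoCard W (-2) = 1) ∨
      (twistSelmerTwoCard W (-1) = 1 ∧ twistSelmerTwoCard W 2 = 4 ∧ twistSelmerTwoCard W (-2) = 1) ∨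
      (twistSelmerTwoCard W (-1) = 1 ∧ twistSelmerTwoCard W 2 = 1 ∧ twistSelmerTwoCard W (-2) = 4)

/-- **AN-32⁺o `OrdinaryWildPairAtTwo` (THEOREM-CANDIDATE; 152/152: (0,0) 16, (1,1) 136, mixed 0).** Good ordinary at `2`, `E(ℚ₂)[2] ≅ ℤ/2`, `β = 1`:
the two packet twins with `(Δ,δ)₂ = −1` (`i₂ = 1`), both silent at `∞`, have the SAME `2`-Selmer cardinality (`∈ {1, 4}`) — their norm lines coincide.
REF1 §114: SURVIVES; r3 (D-an-69): both norm lines equal the FORMAL-GROUP line `(E₁(ℚ₂) + 2E(ℚ₂))/2E(ℚ₂)` (norms from a ramified quadratic extension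
reduce into `2Ẽ(𝔽₂)`, index 2 = Kramer Prop. 5), so the reading is `(4,4) ⟺ R̃ ∈ 2Ẽ(𝔽₂)` (212/212); the torsion line `⟨T⟩` only when
`E(ℚ₂)[4] = E(ℚ₂)[2]`. [cite: Kramer1981, Prop. 5] [cite: MazurRubin2010, proof of Prop. 3.3] -/
def OrdinaryWildPairAtTwo : Prop :=
  ∀ (W : WeierstrassCurve ℚ) [W.IsElliptic] [W.IsGloballyMinimal], GoodOrd W 2 → TwoTorsionLineAtTwo W → SliceRowAtTwo W → LocallyPrimitiveAtTwo W →
    ∀ δ₁ δ₂ : ℤ, WildPacketDelta δ₁ → WildPacketDelta δ₂ → discHilbertAtTwo W δ₁ = -1 → discHilbertAtTwo W δ₂ = -1 →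
      ArchSilentAtTwo W δ₁ → ArchSilentAtTwo W δ₂ →
      (twistSelmerTwoCard W δ₁ = 1 ∨ twistSelmerTwoCard W δ₁ = 4) ∧ twistSelmerTwoCard W δ₁ = twistSelmerTwoCard W δ₂

/-- **AN-32⁺f `OrdinaryFullTwinAtTwo` (THEOREM-CANDIDATE; 178/178).** Good ordinary at `2`, `E(ℚ₂)[2] ≅ ℤ/2`, `β = 1`: a packet twin with `(Δ,δ)₂ = +1`
(`i₂ = 2`: transversal local conditions at `2`) and silent at `∞` has `#Sel₂(E^{(δ)}) = 2` EXACTLY (`t = 2`, `r = 1`, `b = 1`). [cite: Kramer1981, Prop. 5] -/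
def OrdinaryFullTwinAtTwo : Prop :=
  ∀ (W : WeierstrassCurve ℚ) [W.IsElliptic] [W.IsGloballyMinimal], GoodOrd W 2 → TwoTorsionLineAtTwo W → SliceRowAtTwo W → LocallyPrimitiveAtTwo W →
    ∀ δ : ℤ, WildPacketDelta δ → discHilbertAtTwo W δ = 1 → ArchSilentAtTwo W δ → twistSelmerTwoCard W δ = 2

/-- glue: the trit law follows from the pairwise line-distinctness law (three partial twins, pairwise never both `4`, each `∈ {1,4}`, and NOT all `1`:
the last needs the covering fact "three distinct lines exhaust the plane", which we keep as the separate hypothesis `h3`). -/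
theorem splitWildTrit_of_lines (hL : MultiplicativeWildLinesDistinctAtTwo)
    (h3 : ∀ (W : WeierstrassCurve ℚ) [W.IsElliptic] [W.IsGloballyMinimal], W.HasSplitMultiplicativeReductionAtPrime 2 → TwoTorsionLineAtTwo W →
      SliceRowAtTwo W → LocallyPrimitiveAtTwo W → W.Δ < 0 → discHilbertAtTwo W (-1) = 1 → discHilbertAtTwo W 2 = 1 → discHilbertAtTwo W (-2) = 1 →
      ¬ (twistSelmerTwoCard W (-1) = 1 ∧ twistSelmerTwoCard W 2 = 1 ∧ twistSelmerTwoCard W (-2) = 1)) :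
    SplitWildTritAtTwo := by
  intro W _ _ hs hT hrow hβ hΔ h1 h2 h3'
  have hm : W.HasMultiplicativeReductionAtPrime 2 := hs.hasMultiplicativeReductionAtPrime
  have pm1 : MultiplicativePartialAtTwo W (-1) := Or.inl ⟨hs, h1⟩
  have p2 : MultiplicativePartialAtTwo W 2 := Or.inl ⟨hs, h2⟩
  have pm2 : MultiplicativePartialAtTwo W (-2) := Or.inl ⟨hs, h3'⟩
  have am1 : ArchSilentAtTwo W (-1) := Or.inl hΔ
  have a2 : ArchSilentAtTwo W 2 := Or.inl hΔ
  have am2 : ArchSilentAtTwo W (-2) := Or.inl hΔ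
  have dm1 : WildPacketDelta (-1) := Or.inl rfl
  have d2 : WildPacketDelta 2 := Or.inr (Or.inl rfl)
  have dm2 : WildPacketDelta (-2) := Or.inr (Or.inr rfl)
  obtain ⟨vA, nAB⟩ := hL W hm hT hrow hβ (-1) 2 dm1 d2 (by norm_num) pm1 p2 am1 a2
  obtain ⟨vB, nBC⟩ := hL W hm hT hrow hβ 2 (-2) d2 dm2 (by norm_num) p2 pm2 a2 am2
  obtain ⟨vC, nCA⟩ := hL W hm hT hrow hβ (-2) (-1) dm2 dm1 (by norm_num) pm2 pm1 am2 am1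
  have hn := h3 W hs hT hrow hβ hΔ h1 h2 h3'
  rcases vA with hA | hA <;> rcases vB with hB | hB <;> rcases vC with hC | hC <;> simp_all

/-! ### AN-32K′ / AN-32↑′ — the `Addv`-restricted forms (-an g15 Sketch_v23 a407582d2f0b2171 l.209–234, REF1 §111 r1 adopted by -an AFTER p638887;
Theorems files are append-only, so the restricted rows carry NEW names; statements VERBATIM from the sketch with `Addv W₂ 2` (= tree
`Literature.NumberTheory.EllipticCurves.Rank1Residual.Addv`: neither good nor multiplicative at `2`) in place of `¬ W₂.HasGoodReductionAtPrime 2`;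
REF1 §114 r6: «file under the announced new names; statement text = a407582d l.209–234 verbatim»; REF1 §111 verdicts stand) -/

/-- **AN-32K′ `AdditiveTwinUnitValueKillsSelmerTwoAtTwo`** (CONJECTURE-grade = Kato's rank-zero Euler-system bound AT THE ADDITIVE PRIME 2, mod 2;
the Selmer side of crux `AdditiveRankZeroAtTwo` on the unit locus) — the `Addv`-RESTRICTED form of the landed `AdditiveUnitValueKillsSelmerTwoAtTwo`
(p638887, typed over `¬ good at 2` ⊋ additive; REF1 §111 r1).  For `W₂/ℚ` globally minimal, ADDITIVE at `2` (tree `Addv W₂ 2` = neither good nor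
multiplicative), with Kato's image condition at `2`, odd torsion, odd Tamagawa product and `L(W₂, 1)/Ω_{W₂}` a rational `2`-adic UNIT: `Sel₂(W₂) = 0`.
(For the wild twins of the slice: torsion `1`, `c₂ = 1`, Tam odd on 283/283 × 3; unit value ⟺ `#Ш_an` odd, 620/620 on `β = 1`.)  Not in print at `p = 2`
(Kato 2004 Thm. 14.5(3) assumes p ≠ 2 and potentially good reduction; REF2 v30 §1); -es `KatoRankZeroUpperBoundAtTwo` is the GOOD-supersingular sibling;
-es D-an-61: the tree HAS the value-side fact `Kato2004.rankZero_padicValNat_sha_add_padicValNat_tamagawa_le_at_two_of_irreducible_of_fineSelmerDual_fg`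
conditional on Coates–Sujatha (A).  Implied by the landed ¬good form (`additiveTwinUnitValueKillsSelmerTwoAtTwo_of`).
[cite: Kato2004Asterisque, Thm. 12.5, Thm. 14.5, Thm. 17.4] -/
@[conjecture] def AdditiveTwinUnitValueKillsSelmerTwoAtTwo : Prop :=
  ∀ (W₂ : WeierstrassCurve ℚ) [W₂.IsElliptic] [W₂.IsGloballyMinimal], Addv W₂ 2 →
    Kato2004.ImageContainsSL2 W₂ 2 → Odd W₂.torsionOrder → Odd W₂.tamagawaProduct → W₂.analyticRank = 0 →
    (∃ q : ℚ, W₂.entireLFunction 1 / (W₂.realPeriodRat : ℂ) = (q : ℂ) ∧ padicValRat 2 q = 0) → selmerTwoCard W₂ = 1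

/-- The landed (stronger-scope) AN-32K implies its `Addv` restriction (`Addv W₂ 2 → ¬ W₂.HasGoodReductionAtPrime 2`). -/
theorem additiveTwinUnitValueKillsSelmerTwoAtTwo_of (h : AdditiveUnitValueKillsSelmerTwoAtTwo) :
    AdditiveTwinUnitValueKillsSelmerTwoAtTwo :=
  fun W₂ _ _ hadd himg htors htam han hunit => h W₂ hadd.1 himg htors htam han hunit

/-- **AN-32↑′ `UBottomOnPrimitiveLocusAddvAtTwo`** — the U half's bottom rung on `{β = 1}`, Heegner-free, with the twin hypothesis in `Addv` form
(-an a407582d l.221–228 verbatim): on the good-supersingular odd-Tam slice with `ρ_{E,2^∞}` onto, rank one and `β = 1`, if the ADDITIVE twin `E^{(2)}`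
has analytic rank `0` with unit value `L(E^{(2)},1)/Ω = L(E,χ₈,1)/Ω`, odd torsion and odd Tamagawa product, then `Ш(E)[2] = 0`.  PROVED below from
AN-32U + AN-32K′ + the two supports (`uBottomOnPrimitiveLocusAddv_of`), and from the landed ¬good rung by restriction (`uBottomOnPrimitiveLocusAddvAtTwo_of`). -/
def UBottomOnPrimitiveLocusAddvAtTwo : Prop :=
  ∀ (W : WeierstrassCurve ℚ) [W.IsElliptic] [W.IsGloballyMinimal], GoodSS W 2 → Odd W.tamagawaProduct →
    (∀ n : ℕ, W.HasSurjectiveModNGaloisRep ((2 ^ n : ℕ) : ℤ)) → W.mordellWeilRank = 1 → LocallyPrimitiveAtTwo W →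
    ∀ (W₂ : WeierstrassCurve ℚ) [W₂.IsElliptic] [W₂.IsGloballyMinimal] (C : WeierstrassCurve.VariableChange ℚ),
      C • W.quadraticTwist (2 : ℚ) = W₂ → Addv W₂ 2 → Odd W₂.torsionOrder → Odd W₂.tamagawaProduct →
      W₂.analyticRank = 0 → (∃ q : ℚ, W₂.entireLFunction 1 / (W₂.realPeriodRat : ℂ) = (q : ℂ) ∧ padicValRat 2 q = 0) → ShaTwoTrivial W

/-- Kernel glue (-an a407582d, verbatim up to names): AN-32U + AN-32K′ + AN-32M + AN-32i ⟹ AN-32↑′. -/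
theorem uBottomOnPrimitiveLocusAddv_of (hU : ShaTwoReadByWildTwinAtTwo) (hK : AdditiveTwinUnitValueKillsSelmerTwoAtTwo)
    (hM : TwistSelmerModelInvarianceAtTwo) (hI : TwinImageContainsSL2AtTwo) : UBottomOnPrimitiveLocusAddvAtTwo := by
  intro W _ _ hss htam hsurj hrk hβ W₂ _ _ C hC hadd htors htam₂ han hunit
  have himg : Kato2004.ImageContainsSL2 W₂ 2 := hI W W₂ C hC hsurj
  have hsel : selmerTwoCard W₂ = 1 := hK W₂ hadd himg htors htam₂ han hunit
  have hmodel : twistSelmerTwoCard W 2 = selmerTwoCard W₂ := hM W W₂ C hC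
  exact (hU W hss htam hrk hβ).mpr (hmodel.trans hsel)

/-- Restriction: the landed ¬good rung gives the `Addv` rung. -/
theorem uBottomOnPrimitiveLocusAddvAtTwo_of (h : UBottomOnPrimitiveLocusAtTwo) : UBottomOnPrimitiveLocusAddvAtTwo :=
  fun W _ _ hss htam hsurj hrk hβ W₂ _ _ C hC hadd htors htam₂ han hunit =>
    h W hss htam hsurj hrk hβ W₂ C hC hadd.1 htors htam₂ han hunit


end Summit.BirchSwinnertonDyer.Rank1Residual.F1Sign2.WildPacket

end
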